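/-
Copyright (c) 2026. All rights reserved.
Released under Apache 2.0 license as described in the file LICENSE.
-/
import Mathlib

/-!
# A quiet plane: flat Fubini over coordinate planes and Chebyshev on average

ROUND-42 (B2) of the condenser programme for the crux class
`PowerGaugeEulerLiouville` (MODEL lattice only; the crux `stmt-…-19832` is a class of
Euler / Navier–Stokes strata, not Navier–Stokes regularity).

We slice `EuclideanSpace ℝ (Fin 3)` by the coordinate planes `{x | x 2 = s}`:
`plane s a` is the point with in-plane coordinates `a : EuclideanSpace ℝ (Fin 2)` and height `s`.

* `planeEquiv` : the measurable equivalence `E³ ≃ᵐ ℝ × E²`, `x ↦ (x 2, (x 0, x 1))`; it is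
  volume preserving (`measurePreserving_planeEquiv`) and `planeEquiv.symm (s, a) = plane s a`.
* (QP1) `integral_integral_plane` : `∫ s, ∫ a, H (plane s a) = ∫ x, H x` for integrable `H`,
  together with `integrable_integral_plane` (the slice integral is integrable in `s`).
* (QP2) `exists_quietPlane` : CHEBYSHEV ON AVERAGE — if `F, G ≥ 0` are continuous with
  `∫_{B(0,3R)} F ≤ X`, `∫_{B(0,3R)} G ≤ Y`, then some height `s ∈ [R, 2R]` carries a plane on
  which both truncated slice integrals are `≤ 4X/R`, `≤ 4Y/R`: the set of bad heights for each
  function has measure `≤ R/4` by Markov (`volume_real_badHeights_le`), and `[R, 2R]` has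
  measure `R`.

The consumer rotates the fields by a linear isometry first, so coordinate planes suffice.
All statements are [folklore].
-/

noncomputable section

set_option linter.dupNamespace false

open MeasureTheory Set Metric
open scoped ENNReal

namespace Summit.NavierStokesRegularity.NavierStokesRegularity.Theorems.PowerGaugeEulerLiouville.Condenser

/-! ### Coordinate planes -/

/-- The point of the coordinate plane `{x | x 2 = s}` with in-plane coordinates `a`:
`plane s a = (a 0, a 1, s)`. -/
def plane (s : ℝ) (a : EuclideanSpace ℝ (Fin 2)) : EuclideanSpace ℝ (Fin 3) :=
  WithLp.toLp 2 ![a 0, a 1, s]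

/-- First coordinate of `plane s a`. -/
@[simp] theorem plane_apply_zero (s : ℝ) (a : EuclideanSpace ℝ (Fin 2)) : plane s a 0 = a 0 :=
  rfl

/-- Second coordinate of `plane s a`. -/
@[simp] theorem plane_apply_one (s : ℝ) (a : EuclideanSpace ℝ (Fin 2)) : plane s a 1 = a 1 :=
  rfl

/-- Third coordinate of `plane s a` (the height). -/
@[simp] theorem plane_apply_two (s : ℝ) (a : EuclideanSpace ℝ (Fin 2)) : plane s a 2 = s :=
  rfl

/-- The measurable equivalence `E³ ≃ᵐ ℝ × E²`, `x ↦ (x 2, (x 0, x 1))`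
(through `Fin 3 → ℝ` and `MeasurableEquiv.piFinSuccAbove _ 2`). -/
def planeEquiv : EuclideanSpace ℝ (Fin 3) ≃ᵐ ℝ × EuclideanSpace ℝ (Fin 2) :=
  (((MeasurableEquiv.toLp 2 (Fin 3 → ℝ)).symm.trans
    (MeasurableEquiv.piFinSuccAbove (fun _ : Fin 3 => ℝ) 2)).trans
    (MeasurableEquiv.prodCongr (MeasurableEquiv.refl ℝ) (MeasurableEquiv.toLp 2 (Fin 2 → ℝ))))

/-- The inverse of `planeEquiv` is the slicing map `plane`. -/
theorem planeEquiv_symm_apply (s : ℝ) (a : EuclideanSpace ℝ (Fin 2)) :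
    planeEquiv.symm (s, a) = plane s a := by
  ext i
  fin_cases i
  · simp [planeEquiv, plane, MeasurableEquiv.piFinSuccAbove_symm_apply, Fin.insertNth_apply_below]
    rfl
  · simp [planeEquiv, plane, Fin.insertNth_apply_below]
    rfl
  · rfl

/-- `planeEquiv` preserves Lebesgue measure. -/
theorem measurePreserving_planeEquiv : MeasurePreserving planeEquiv volume volume := by
  have h1 := EuclideanSpace.volume_preserving_symm_measurableEquiv_toLp (Fin 3)
  have h2 := volume_preserving_piFinSuccAbove (fun _ : Fin 3 => ℝ) 2
  have h3 := (EuclideanSpace.volume_preserving_symm_measurableEquiv_toLp (Fin 2)).symm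
  have h4 : MeasurePreserving
      (MeasurableEquiv.prodCongr (MeasurableEquiv.refl ℝ) (MeasurableEquiv.toLp 2 (Fin 2 → ℝ)))
      volume volume := by
    rw [Measure.volume_eq_prod, Measure.volume_eq_prod]
    exact (MeasurePreserving.id volume).prod h3
  exact (h1.trans h2).trans h4

/-- The slicing map `plane s` is measurable. -/
theorem measurable_plane (s : ℝ) : Measurable (plane s) := by
  have h : Measurable fun a : EuclideanSpace ℝ (Fin 2) => planeEquiv.symm (s, a) :=
    planeEquiv.symm.measurable.comp (measurable_const.prodMk measurable_id)
  simpa only [planeEquiv_symm_apply] using h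

/-! ### (QP1) Flat Fubini over coordinate planes -/

/-- An integrable function stays integrable after the change of variables `planeEquiv.symm`. -/
theorem integrable_comp_planeEquiv_symm {H : EuclideanSpace ℝ (Fin 3) → ℝ} (hH : Integrable H) :
    Integrable (fun p : ℝ × EuclideanSpace ℝ (Fin 2) => H (planeEquiv.symm p))
      ((volume : Measure ℝ).prod volume) := by
  rw [← Measure.volume_eq_prod]
  exact (measurePreserving_planeEquiv.symm.integrable_comp_emb
    planeEquiv.symm.measurableEmbedding).mpr hH

/-- (QP1) FUBINI over coordinate planes: `∫ s, ∫ a, H (plane s a) = ∫ x, H x`. -/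
theorem integral_integral_plane (H : EuclideanSpace ℝ (Fin 3) → ℝ) (hH : Integrable H) :
    ∫ s, ∫ a, H (plane s a) = ∫ x, H x := by
  have hint := integrable_comp_planeEquiv_symm hH
  calc ∫ s, ∫ a, H (plane s a)
      = ∫ s, ∫ a, H (planeEquiv.symm (s, a)) := by simp_rw [planeEquiv_symm_apply]
    _ = ∫ p, H (planeEquiv.symm p) ∂((volume : Measure ℝ).prod volume) :=
        (integral_prod _ hint).symm
    _ = ∫ x, H x := by
        rw [← Measure.volume_eq_prod]
        exact measurePreserving_planeEquiv.symm.integral_comp' H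

/-- (QP1') The slice integral `s ↦ ∫ a, H (plane s a)` of an integrable `H` is integrable. -/
theorem integrable_integral_plane (H : EuclideanSpace ℝ (Fin 3) → ℝ) (hH : Integrable H) :
    Integrable fun s => ∫ a, H (plane s a) := by
  have h := (integrable_comp_planeEquiv_symm hH).integral_prod_left
  simpa only [planeEquiv_symm_apply] using h

/-! ### (QP2) Chebyshev on average -/

/-- The truncation `𝟙_{B(0,r)} F` of a continuous function is integrable. -/
theorem integrable_indicator_ball_of_continuous {F : EuclideanSpace ℝ (Fin 3) → ℝ}
    (hFc : Continuous F) (r : ℝ) :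
    Integrable ((ball (0 : EuclideanSpace ℝ (Fin 3)) r).indicator F) :=
  (integrable_indicator_iff measurableSet_ball).mpr
    ((hFc.continuousOn.integrableOn_compact (isCompact_closedBall 0 r)).mono_set
      ball_subset_closedBall)

/-- The truncated slice integral `h_F(s) = ∫ a, 𝟙_{B(0,r)} F (plane s a)` is nonnegative for
`F ≥ 0`. -/
theorem integral_indicator_plane_nonneg {F : EuclideanSpace ℝ (Fin 3) → ℝ} (hF0 : ∀ x, 0 ≤ F x)
    (r s : ℝ) : 0 ≤ ∫ a, (ball (0 : EuclideanSpace ℝ (Fin 3)) r).indicator F (plane s a) :=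
  integral_nonneg fun _ => Set.indicator_nonneg (fun x _ => hF0 x) _

/-- The total of the truncated slice integrals is the ball integral:
`∫ s, h_F(s) = ∫_{B(0,r)} F`. -/
theorem integral_integral_indicator_plane {F : EuclideanSpace ℝ (Fin 3) → ℝ} (hFc : Continuous F)
    (r : ℝ) :
    ∫ s, ∫ a, (ball (0 : EuclideanSpace ℝ (Fin 3)) r).indicator F (plane s a)
      = ∫ x in ball (0 : EuclideanSpace ℝ (Fin 3)) r, F x := by
  rw [integral_integral_plane _ (integrable_indicator_ball_of_continuous hFc r),
    integral_indicator measurableSet_ball]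

/-- MARKOV ON HEIGHTS: if `F ≥ 0` is continuous with `∫_{B(0,3R)} F ≤ X`, the heights
`s ∈ [R, 2R]` whose truncated slice integral is `≥ 4X/R` form a set of measure `≤ R/4`. -/
theorem volume_real_badHeights_le {F : EuclideanSpace ℝ (Fin 3) → ℝ} (hFc : Continuous F)
    (hF0 : ∀ x, 0 ≤ F x) {R X : ℝ} (hR : 0 < R) (hX : 0 < X)
    (hFX : ∫ x in ball (0 : EuclideanSpace ℝ (Fin 3)) (3 * R), F x ≤ X) :
    volume.real ({s | 4 * X / R ≤
        ∫ a, (ball (0 : EuclideanSpace ℝ (Fin 3)) (3 * R)).indicator F (plane s a)} ∩ Icc R (2 * R))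
      ≤ R / 4 := by
  set h : ℝ → ℝ := fun s =>
    ∫ a, (ball (0 : EuclideanSpace ℝ (Fin 3)) (3 * R)).indicator F (plane s a) with hh
  have hint : Integrable h :=
    integrable_integral_plane _ (integrable_indicator_ball_of_continuous hFc (3 * R))
  have hnn : ∀ s, 0 ≤ h s := fun s => integral_indicator_plane_nonneg hF0 (3 * R) s
  have htot : ∫ s, h s ≤ X := by
    rw [hh, integral_integral_indicator_plane hFc (3 * R)]
    exact hFX
  have hε : 0 < 4 * X / R := by positivity
  -- Markov for the restriction of Lebesgue measure to `[R, 2R]`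
  have hM := mul_meas_ge_le_integral_of_nonneg (μ := volume.restrict (Icc R (2 * R)))
    (ae_of_all _ hnn) hint.restrict (4 * X / R)
  have hset : ∫ s in Icc R (2 * R), h s ≤ X :=
    (setIntegral_le_integral hint (ae_of_all _ hnn)).trans htot
  rw [measureReal_restrict_apply' measurableSet_Icc] at hM
  have hle : 4 * X / R * volume.real ({s | 4 * X / R ≤ h s} ∩ Icc R (2 * R)) ≤ X := hM.trans hset
  have : volume.real ({s | 4 * X / R ≤ h s} ∩ Icc R (2 * R)) ≤ X / (4 * X / R) := by
    rw [le_div_iff₀ hε, mul_comm]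
    exact hle
  calc volume.real ({s | 4 * X / R ≤ h s} ∩ Icc R (2 * R)) ≤ X / (4 * X / R) := this
    _ = R / 4 := by field_simp

/-- (QP2) CHEBYSHEV ON AVERAGE — A QUIET PLANE. If `F, G ≥ 0` are continuous with
`∫_{B(0,3R)} F ≤ X` and `∫_{B(0,3R)} G ≤ Y`, then some coordinate plane at height `s ∈ [R, 2R]`
has both truncated slice integrals small: `∫ 𝟙_{B(0,3R)} F ∘ plane s ≤ 4X/R` and
`∫ 𝟙_{B(0,3R)} G ∘ plane s ≤ 4Y/R`. -/
theorem exists_quietPlane {F G : EuclideanSpace ℝ (Fin 3) → ℝ} (hFc : Continuous F)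
    (hGc : Continuous G) (hF0 : ∀ x, 0 ≤ F x) (hG0 : ∀ x, 0 ≤ G x) {R X Y : ℝ} (hR : 0 < R)
    (hX : 0 < X) (hY : 0 < Y) (hFX : ∫ x in ball (0 : EuclideanSpace ℝ (Fin 3)) (3 * R), F x ≤ X)
    (hGY : ∫ x in ball (0 : EuclideanSpace ℝ (Fin 3)) (3 * R), G x ≤ Y) :
    ∃ s ∈ Icc R (2 * R),
      ∫ a, (ball (0 : EuclideanSpace ℝ (Fin 3)) (3 * R)).indicator F (plane s a) ≤ 4 * X / R ∧
      ∫ a, (ball (0 : EuclideanSpace ℝ (Fin 3)) (3 * R)).indicator G (plane s a) ≤ 4 * Y / R := by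
  set hF : ℝ → ℝ := fun s =>
    ∫ a, (ball (0 : EuclideanSpace ℝ (Fin 3)) (3 * R)).indicator F (plane s a) with hhF
  set hG : ℝ → ℝ := fun s =>
    ∫ a, (ball (0 : EuclideanSpace ℝ (Fin 3)) (3 * R)).indicator G (plane s a) with hhG
  have hBF := volume_real_badHeights_le hFc hF0 hR hX hFX
  have hBG := volume_real_badHeights_le hGc hG0 hR hY hGY
  by_contra hne
  push Not at hne
  -- every height in `[R, 2R]` is bad for `F` or for `G`
  have hcover : Icc R (2 * R) ⊆
      ({s | 4 * X / R ≤ hF s} ∩ Icc R (2 * R)) ∪ ({s | 4 * Y / R ≤ hG s} ∩ Icc R (2 * R)) := by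
    intro s hs
    by_cases h1 : hF s ≤ 4 * X / R
    · exact Or.inr ⟨(hne s hs h1).le, hs⟩
    · exact Or.inl ⟨(not_le.mp h1).le, hs⟩
  have hfin : volume (({s | 4 * X / R ≤ hF s} ∩ Icc R (2 * R)) ∪
      ({s | 4 * Y / R ≤ hG s} ∩ Icc R (2 * R))) ≠ ∞ :=
    (measure_mono (union_subset inter_subset_right inter_subset_right)).trans_lt
      measure_Icc_lt_top |>.ne
  have hIcc : volume.real (Icc R (2 * R)) = R := by
    rw [Real.volume_real_Icc_of_le (by linarith)]
    ring
  have hchain := (measureReal_mono hcover hfin).trans (measureReal_union_le _ _)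
  rw [hIcc] at hchain
  linarith
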